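import Summits.Langlands.Langlands.Theorems.IrreducibilityBySelfDualityIrreducibleOffSectorOfReciprocity
import Summits.Langlands.Langlands.Theorems.IrreducibilityBySelfDualityReciprocityUpToIrreducibilityGeometricConstituents
import Literature.NumberTheory.Automorphic.QuadraticBaseChangeFrobCompatibleCarayolProofs
import Literature.NumberTheory.Automorphic.SatakeParamNeZeroProofs
import Literature.NumberTheory.Automorphic.ArchParameterUnique
import HarnessLib

/-!
# `IrreducibleOffSector` in rank two for regular `π` — a child of the crux settled modulo the
# route's printed inputs only (no reciprocity hypothesis)
(crux stmt-Langlands-14329 `IrreducibilityBySelfDuality.IrreducibleOffSector`, line `Sketch`;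
`--supports` file, STRUCTURAL: no import of the route module)

**Theorem** (`isIrreducible_rank_two_of_isRegular`).  Grant Böckle–Hui 2025 Thm. 1.1 in its
cofinite `GL(1)` form (the text of the route item `WeakAbelianSummandHecke`, a THEOREM of the tree),
Clozel's Hecke field (the text of the route input `HeckeEigenvalueField`, Clozel 1990 Thm. 3.13) and
Arthur–Clozel (2.2)–(2.3) for Borel–Jacquet data.  Let `K` be ANY number field, `π` a cuspidal datum on
`GL_2(𝔸_K)`, L-algebraic with a REGULAR infinity type, `ι : ℚ̄_ℓ ≃ ℂ`.  Then every
`ρ : Γ_K → GL_2(ℚ̄_ℓ)` that is Satake–Frobenius compatible with `(π, ι)` at almost all places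
(summit normalisation `arithFrobPolyOfSatake ι q_v 1 α`) is irreducible.

This is the rank-two case of Ramakrishnan's "cuspidal ⇒ irreducible" (Ribet 1977 / Taylor 1995 for
Hilbert modular forms; here over every number field, vacuously where no compatible `ρ` exists), by
the Böckle–Hui route of the sector theorem `IrreducibleGL3CM` one rank down, where no self-duality
is needed: both Jordan–Hölder constituents of a reducible rank-two representation are characters.

**Proof.**  Reduce to semisimple `ρ` (`isIrreducible_of_forall_isSemisimple`, p79199).  The twist
`π' = π ⊗ |det|^{1/2}` is regular algebraic (`isRegularAlgebraic_of_hasInfinityType_twist_half`), so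
Clozel's Hecke field `E ⊂ ℂ` of `π'` is a number field containing `√q_v (b₁ + b₂)` and `b₁ b₂` for the
Satake parameter `{b₁, b₂}` of `π'` at almost every `v`; the Satake parameter of `π` there is
`{√q_v b₁, √q_v b₂}` (`hasSatakeParamAt_map_cpow_of_twist`), whence the Frobenius polynomial
`(X - ι⁻¹((√q b₁)⁻¹))(X - ι⁻¹((√q b₂)⁻¹))` of `ρ` is defined over `ι⁻¹(E)`: `ρ` is `E`-rational
(`eventually_rational_rank_two`).  If `ρ` were reducible, a change of frame makes it upper
triangular with continuous diagonal characters `A`, `D` (`exists_conj_continuous_blocks_of_subrepresentation`),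
unramified wherever `ρ` is, with `det(X - ρ σ) = det(X - A σ) det(X - D σ)`; so `A` and `D` weakly
divide `ρ`, and Böckle–Hui's theorem attaches cuspidal `GL(1)` data `χ_A`, `χ_D` with Satake
parameters `{c_v}`, `{d_v}` and `A`, `D` of Frobenius polynomials `X - ι⁻¹(c_v⁻¹)`, `X - ι⁻¹(d_v⁻¹)`
a.e.  Multiplicativity and injectivity of `arithFrobPolyOfSatake ι q 1` give `t_{π,v} = {c_v} + {d_v}`
at almost every `v`, which isobaric rigidity for `GL_2` versus `GL_1 ⊞ GL_1` forbids
(`isobaricRigidity_of_JS`, Jacquet–Shalika II Thm. 4.4, p102635).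

References: G. Böckle, C. Y. Hui, *Weak abelian direct summands and irreducibility of Galois
representations* (2025), Thm. 1.1, §3.2.1; K. Ribet, *Galois representations attached to eigenforms
with Nebentypus*, LNM 601 (1977), Thm. 2.3; R. Taylor, *On Galois representations associated to
Hilbert modular forms II* (1995), Prop.; H. Jacquet, J. Shalika, Amer. J. Math. 103 (1981) II,
Thm. 4.4; K. Buzzard, T. Gee, LMS LNS 414 (2014), §5.3.
-/

noncomputable section

set_option linter.dupNamespace false

open scoped NumberField Classical Polynomial
open Filter IsDedekindDomain Polynomial NumberField
open Literature.NumberTheory.Automorphic Literature.NumberTheory.GaloisRepresentations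
open Summit.Langlands

namespace Summit.Langlands.Langlands.Theorems.IrreducibleOffSector

/-! ### Bookkeeping: the half-twist exponent -/

/-- The half-twist exponent for `GL₂`: `q^{(2-1)/2} = √q` in `ℂ`. [folklore] -/
theorem natCast_cpow_half_two (q : ℕ) :
    (q : ℂ) ^ ((((2 : ℝ) - 1) / 2 : ℝ) : ℂ) = ((Real.sqrt q : ℝ) : ℂ) := by
  have h : (((2 : ℝ) - 1) / 2 : ℝ) = 1 / 2 := by norm_num
  rw [h, show (q : ℂ) = ((q : ℝ) : ℂ) by norm_cast, ← Complex.ofReal_cpow (Nat.cast_nonneg q),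
    Real.sqrt_eq_rpow]

/-! ### `E`-rationality of the Frobenius polynomial in rank two (Böckle–Hui §3.1 for `n = 2`,
L-normalisation) -/

section Rational

variable {ℓ : ℕ} [Fact ℓ.Prime]

/-- **`arithFrobPolyOfSatake ι q 1 {√q b₁, √q b₂}` is defined over the Hecke field of the regular
algebraic twist.**  If `β = {b₁, b₂}` has non-zero entries and `√q e₁(β)`, `e₂(β)` lie in the subfield
`E ⊆ ℂ`, then `(X - ι⁻¹((√q b₁)⁻¹))(X - ι⁻¹((√q b₂)⁻¹))` is the image under `ι⁻¹|_E` of a polynomial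
over `E` (its coefficients are `√q e₁ / (q e₂)` and `1 / (q e₂)`). [cite: BockleHui2025, §3.1] -/
theorem exists_polynomial_map_eq_arithFrobPolyOfSatake_one_twist_two (ι : PadicAlgCl ℓ ≃+* ℂ)
    (E : Subfield ℂ) {q : ℕ} (hq : 0 < q) {β : Multiset ℂ} (hcard : Multiset.card β = 2)
    (hne : ∀ b ∈ β, b ≠ 0)
    (hE : ∀ i ≤ 2, ((((Real.sqrt (q : ℝ)) : ℝ) : ℂ) ^ (i * (2 - i))) * β.esymm i ∈ E) :
    ∃ P : Polynomial E,
      P.map ((ι.symm : ℂ ≃+* PadicAlgCl ℓ).toRingHom.comp E.subtype) =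
        arithFrobPolyOfSatake ι q 1 (β.map ((((Real.sqrt (q : ℝ)) : ℝ) : ℂ) * ·)) := by
  have ht1 := hE 1 (by norm_num)
  have ht2 := hE 2 le_rfl
  obtain ⟨b₁, b₂, rfl⟩ := Multiset.card_eq_two.1 hcard
  have hb₁ : b₁ ≠ 0 := hne b₁ (by simp)
  have hb₂ : b₂ ≠ 0 := hne b₂ (by simp)
  -- `e₁{b₁, b₂} = b₁ + b₂`, `e₂{b₁, b₂} = b₁ b₂` (the tree's `esymm_one_pair` / `esymm_two_pair` of
  -- `…ProModularOrdinaryClassicalSatakeDictionary`, recomputed here to keep the imports of this line)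
  have he1 : ({b₁, b₂} : Multiset ℂ).esymm 1 = b₁ + b₂ := by
    simp only [Multiset.esymm, Multiset.insert_eq_cons, Multiset.powersetCard_one, Multiset.map_cons,
      Multiset.map_singleton, Multiset.prod_singleton, Multiset.sum_cons, Multiset.sum_singleton]
  have he2 : ({b₁, b₂} : Multiset ℂ).esymm 2 = b₁ * b₂ := by
    simp [Multiset.esymm, Multiset.powersetCard_one, Multiset.insert_eq_cons,
      Multiset.powersetCard_cons]
  rw [he1] at ht1
  rw [he2] at ht2
  norm_num at ht1 ht2
  -- `√q`
  set sq : ℂ := ((Real.sqrt (q : ℝ) : ℝ) : ℂ) with hsq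
  have hsq2 : sq ^ 2 = (q : ℂ) := by
    rw [hsq, ← Complex.ofReal_pow, Real.sq_sqrt (Nat.cast_nonneg _), Complex.ofReal_natCast]
  have hsq0 : sq ≠ 0 := by
    rw [hsq, Complex.ofReal_ne_zero]
    exact Real.sqrt_ne_zero'.2 (by exact_mod_cast hq)
  have hqE : sq ^ 2 ∈ E := by rw [hsq2]; exact natCast_mem E q
  -- the inverse roots `u = (√q b₁)⁻¹`, `w = (√q b₂)⁻¹` and their symmetric functions
  set u : ℂ := (sq * b₁)⁻¹ with hu
  set w : ℂ := (sq * b₂)⁻¹ with hw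
  have hS1 : u + w ∈ E := by
    have e : u + w = sq * (b₁ + b₂) * (sq ^ 2 * (b₁ * b₂))⁻¹ := by
      rw [hu, hw]
      field_simp
      ring
    rw [e]
    exact mul_mem ht1 (inv_mem (mul_mem hqE ht2))
  have hS2 : u * w ∈ E := by
    have e : u * w = (sq ^ 2 * (b₁ * b₂))⁻¹ := by
      rw [hu, hw]
      field_simp
    rw [e]
    exact inv_mem (mul_mem hqE ht2)
  refine ⟨X ^ 2 - C (⟨u + w, hS1⟩ : E) * X + C (⟨u * w, hS2⟩ : E), ?_⟩
  simp only [arithFrobPolyOfSatake, Multiset.insert_eq_cons, Multiset.map_cons,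
    Multiset.map_singleton, Multiset.prod_cons, Multiset.prod_singleton, Polynomial.map_add,
    Polynomial.map_sub, Polynomial.map_mul, Polynomial.map_pow, map_X, map_C,
    RingHom.coe_comp, Function.comp_apply, RingEquiv.toRingHom_eq_coe, RingEquiv.coe_toRingHom,
    Subfield.coe_subtype, map_add, map_mul]
  have h10 : (1 - 1 : ℕ) = 0 := rfl
  rw [h10, pow_zero, one_mul, one_mul, ← hu, ← hw]
  ring

end Rational

/-! ### Cofinite `E`-rationality of an avatar, through the regular algebraic twist -/

section Cofinite

variable {K : Type} [Field K] [NumberField K] {hcpt : isCompact_glFiniteIntegralLevel 2 K}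
  {ℓ : ℕ} [Fact ℓ.Prime]

/-- **Cofinite `E`-rationality in rank two** (the `E`-rationality hypothesis of Böckle–Hui's
Thm. 1.1, from Clozel's Hecke field of the twist): if `π' = π ⊗ |det|^{1/2}` (`W_{π'} = |det|^{1/2} W_π`)
has its Hecke eigenvalues `√q_v e₁(β_v)`, `e₂(β_v)` in `E ⊆ ℂ` at almost all `v`, and `r` is
Satake–Frobenius compatible with `(π, ι)` at almost all `v` (summit normalisation), then at almost all
`v`, `r` is unramified with Frobenius polynomial defined over `E` (via `ι⁻¹|_E`).
[cite: BockleHui2025, §3.1] [cite: BuzzardGeeLMS2014, §5.3] -/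
theorem eventually_rational_rank_two (ι : PadicAlgCl ℓ ≃+* ℂ)
    {π π' : CuspidalAutomorphicRepData 2 K hcpt} {χ : HeckeCharacter K}
    (hχ : ∀ x : ideleGroup K,
      ((χ x : ℂˣ) : ℂ) = (ideleNorm x : ℂ) ^ ((((2 : ℝ) - 1) / 2 : ℝ) : ℂ))
    (hW : π'.1.W = π.1.W.map (mulChar (detTwist 2 χ)))
    (hW' : π'.1.W' = π.1.W'.map (mulChar (detTwist 2 χ)))
    (E : Subfield ℂ)
    (hE : ∀ᶠ v : HeightOneSpectrum (𝓞 K) in cofinite, ∀ β : Multiset ℂ, π'.1.HasSatakeParamAt v β →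
      ∀ i ≤ 2, ((((Real.sqrt (v.residueCard : ℝ)) : ℝ) : ℂ) ^ (i * (2 - i))) * β.esymm i ∈ E)
    (r : FramedGaloisRep K (PadicAlgCl ℓ) 2)
    (hr : ∀ᶠ v : HeightOneSpectrum (𝓞 K) in cofinite, SatakeFrobCompatibleAt ι π.1 r v) :
    ∀ᶠ v : HeightOneSpectrum (𝓞 K) in cofinite, r.IsUnramifiedAt v ∧
      ∃ P : Polynomial E,
        r.HasFrobCharpolyAt v (P.map ((ι.symm : ℂ ≃+* PadicAlgCl ℓ).toRingHom.comp E.subtype)) := by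
  have hcof : ∀ᶠ v : HeightOneSpectrum (𝓞 K) in cofinite, π'.1.IsUnramifiedAt v :=
    π'.1.hasSatakeParamAt_cofinite_holds
  filter_upwards [hcof, hr, hE] with v hv hrv hEv
  obtain ⟨β, hβ⟩ := hv
  obtain ⟨α, hα, hunr, hP⟩ := hrv
  refine ⟨hunr, ?_⟩
  -- the Satake parameter of `π` at `v` is `√q_v β`
  have hα' := hasSatakeParamAt_map_cpow_of_twist hχ hW hW' hβ
  simp only [natCast_cpow_half_two] at hα'
  obtain rfl := AutomorphicRepData.hasSatakeParamAt_unique_holds π.1 hα hα'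
  obtain ⟨P, hPmap⟩ := exists_polynomial_map_eq_arithFrobPolyOfSatake_one_twist_two ι E
    (lt_trans zero_lt_one v.one_lt_residueCard) hβ.card_eq (hasSatakeParamAt_ne_zero_holds hβ)
    (hEv β hβ)
  exact ⟨P, fun 𝔓 h𝔓 σ hσ => (hP 𝔓 h𝔓 σ hσ).trans hPmap.symm⟩

omit [NumberField K] in
/-- **The two characters of a reducible rank-two representation.**  If `r : Γ_K → GL_2(ℚ̄_ℓ)` is
not irreducible, a change of frame makes it upper triangular with continuous diagonal characters
`A`, `D` (`exists_conj_continuous_blocks_of_subrepresentation`): `det(X - r g) = det(X - A g) det(X - D g)`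
for every `g`, and `A`, `D` are unramified wherever `r` is. Curtis–Reiner, *Methods* I, §16B.
[folklore] -/
theorem exists_blocks_of_not_isIrreducible_two (r : FramedGaloisRep K (PadicAlgCl ℓ) 2)
    (hirr : ¬ r.toGaloisRep.IsIrreducible) :
    ∃ (A D : FramedGaloisRep K (PadicAlgCl ℓ) 1),
      (∀ g, r.charpoly g = A.charpoly g * D.charpoly g) ∧
      (∀ v : HeightOneSpectrum (𝓞 K), r.IsUnramifiedAt v → A.IsUnramifiedAt v ∧ D.IsUnramifiedAt v) := by
  -- a proper non-zero stable subspace of `ℚ̄_ℓ²`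
  have hirr' : ¬ IsSimpleOrder (Subrepresentation (FramedRep.toRepresentation r)) := hirr
  have hW : ∃ W : Subrepresentation (FramedRep.toRepresentation r), W ≠ ⊥ ∧ W ≠ ⊤ := by
    by_contra hcon
    push Not at hcon
    have hbt : (⊥ : Subrepresentation (FramedRep.toRepresentation r)) ≠ ⊤ := by
      intro h
      have h' := congrArg Subrepresentation.toSubmodule h
      change (⊥ : Submodule (PadicAlgCl ℓ) (Fin 2 → PadicAlgCl ℓ)) = ⊤ at h'
      exact bot_ne_top h'
    haveI : Nontrivial (Subrepresentation (FramedRep.toRepresentation r)) := ⟨⟨⊥, ⊤, hbt⟩⟩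
    exact hirr' ⟨fun W ↦ or_iff_not_imp_left.mpr (hcon W)⟩
  obtain ⟨W, hW0, hW1⟩ := hW
  obtain ⟨m, p, hm0, hp0, hmn, hpn, e, P, A, D, hT⟩ :=
    Summit.Langlands.Langlands.Theorems.ReciprocityUpToIrreducibility.exists_conj_continuous_blocks_of_subrepresentation
      (k := PadicAlgCl ℓ) r W hW0 hW1
  obtain rfl : m = 1 := by omega
  obtain rfl : p = 1 := by omega
  refine ⟨A, D, fun g => ?_, fun v hv =>
    Summit.Langlands.Langlands.Theorems.ReciprocityUpToIrreducibility.isUnramifiedAt_blocks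
      e P r A D hT hv⟩
  rw [← Summit.Langlands.Langlands.Theorems.ReciprocityUpToIrreducibility.charpoly_conj_eq P r g]
  exact Summit.Langlands.Langlands.Theorems.ReciprocityUpToIrreducibility.charpoly_eq_mul_of_blockTriangular
    e _ A D hT g

end Cofinite

/-! ### The rank-two regular slice of the crux -/

/-- **`IrreducibleOffSector` in rank two for regular `π`, modulo the route's printed inputs.**  Grant
Böckle–Hui 2025 Thm. 1.1 in cofinite `GL(1)` form (the text of the route item
`WeakAbelianSummandHecke`, a theorem of the tree), Clozel's Hecke field (the text of the input
`HeckeEigenvalueField`) and Arthur–Clozel (2.2)–(2.3) for Borel–Jacquet data.  For every number field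
`K`, every cuspidal `π` on `GL_2(𝔸_K)` that is L-algebraic with a regular infinity type, every `ℓ`,
`ι` and every `ρ : Γ_K → GL_2(ℚ̄_ℓ)` Satake–Frobenius compatible with `(π, ι)` at almost all places,
`ρ` is irreducible. [cite: BockleHui2025, Theorem 1.1 and §3.2.1] [cite: JacquetShalikaAJM1981II, Thm. 4.4] -/
theorem isIrreducible_rank_two_of_isRegular
    (hWA : ∀ (K : Type) [Field K] [NumberField K] (h1 : isCompact_glFiniteIntegralLevel 1 K) (ℓ : ℕ) [Fact ℓ.Prime] (n : ℕ) (E : Type) [Field E] [NumberField E] (e : E →+* PadicAlgCl ℓ) (ρ : Literature.NumberTheory.GaloisRepresentations.FramedGaloisRep K (PadicAlgCl ℓ) n), ρ.toGaloisRep.IsSemisimple → (∀ᶠ v in cofinite, ρ.IsUnramifiedAt v ∧ ∃ P : Polynomial E, ρ.HasFrobCharpolyAt v (P.map e)) → ∀ (ψ : Literature.NumberTheory.GaloisRepresentations.FramedGaloisRep K (PadicAlgCl ℓ) 1), (∀ᶠ v in cofinite, ρ.IsUnramifiedAt v ∧ ψ.IsUnramifiedAt v ∧ ∀ 𝔓 ∈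 v.primesAbove, ∀ σ : Field.absoluteGaloisGroup K, IsArithFrobAt (NumberField.RingOfIntegers K) σ 𝔓 → ψ.charpoly σ ∣ ρ.charpoly σ) → ∀ (ι : PadicAlgCl ℓ ≃+* ℂ), ∃ χ : Literature.NumberTheory.Automorphic.CuspidalAutomorphicRepData 1 K h1, χ.1.IsRegularAlgebraic ∧ ∀ᶠ v in cofinite, ∃ c : ℂ, χ.1.HasSatakeParamAt v {c} ∧ ψ.IsUnramifiedAt v ∧ ψ.HasFrobCharpolyAt v (Literature.NumberTheory.Automorphic.arithFrobPolyOfSatake ι v.residueCard 1 {c}))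
    (hHE : ∀ (n : ℕ) (K : Type) [Field K] [NumberField K] (hcpt : Literature.NumberTheory.Automorphic.isCompact_glFiniteIntegralLevel n K) (π : Literature.NumberTheory.Automorphic.CuspidalAutomorphicRepData n K hcpt), π.1.IsRegularAlgebraic → ∃ E : Subfield ℂ, FiniteDimensional ℚ E ∧ ∀ᶠ v in cofinite, ∀ α : Multiset ℂ, π.1.HasSatakeParamAt v α → ∀ i ≤ n, ((((Real.sqrt (v.residueCard : ℝ)) : ℝ) : ℂ) ^ (i * (n - i))) * α.esymm i ∈ E)
    (h22 : JacquetShalika1981_partialPairL_boundary_repData)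
    (h23 : JacquetShalika1981_partialPairL_pole_repData)
    {K : Type} [Field K] [NumberField K] {hcpt : isCompact_glFiniteIntegralLevel 2 K}
    (π : CuspidalAutomorphicRepData 2 K hcpt) (hL : π.1.IsLAlgebraic)
    (hreg : ∃ T : InfinityType K 2, π.1.HasInfinityType T ∧ T.IsRegular)
    {ℓ : ℕ} [Fact ℓ.Prime] (ι : PadicAlgCl ℓ ≃+* ℂ) (ρ : FramedGaloisRep K (PadicAlgCl ℓ) 2)
    (hρ : ∀ᶠ v : HeightOneSpectrum (𝓞 K) in cofinite, SatakeFrobCompatibleAt ι π.1 ρ v) :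
    ρ.toGaloisRep.IsIrreducible := by
  haveI : NeZero (2 : ℕ) := ⟨two_ne_zero⟩
  -- a regular L-algebraic infinity type of `π` (regularity only reads the `a`-multisets)
  obtain ⟨T, hT, hTL, hTR⟩ :
      ∃ T : InfinityType K 2, π.1.HasInfinityType T ∧ T.IsLAlgebraic ∧ T.IsRegular := by
    obtain ⟨T₁, hT₁, hL₁⟩ := hL
    obtain ⟨T₂, hT₂, hR₂⟩ := hreg
    refine ⟨T₁, hT₁, hL₁, fun σ => ?_⟩
    rw [AutomorphicRepData.HasInfinityType.map_a_eq π.1 hT₁ hT₂ σ]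
    exact hR₂ σ
  -- the regular algebraic twist `π' = π ⊗ |det|^{1/2}` and Clozel's Hecke field of `π'`
  obtain ⟨χ, π', hχ, hW, hW', hT'⟩ := π.exists_twist_hasInfinityType (((2 : ℝ) - 1) / 2) hT
  have hRA : π'.1.IsRegularAlgebraic := isRegularAlgebraic_of_hasInfinityType_twist_half hT' hTL hTR
  obtain ⟨E, hfd, hE⟩ := hHE 2 K hcpt π' hRA
  haveI : FiniteDimensional ℚ E := hfd
  haveI : NumberField E := NumberField.mk
  -- it suffices to treat semisimple avatars
  refine isIrreducible_of_forall_isSemisimple π.1 ι (fun r hss hr => ?_) ρ hρ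
  by_contra hirr
  have h1 : isCompact_glFiniteIntegralLevel 1 K := isCompact_glFiniteIntegralLevel_holds 1 K
  -- `E`-rationality of `r`, and its two characters
  have hrat := eventually_rational_rank_two ι hχ hW hW' E hE r hr
  obtain ⟨A, D, hcp, hur⟩ := exists_blocks_of_not_isIrreducible_two r hirr
  have hrunr : ∀ᶠ v : HeightOneSpectrum (𝓞 K) in cofinite, r.IsUnramifiedAt v :=
    hr.mono fun v hv => hv.choose_spec.2.1
  have hdivA : ∀ᶠ v : HeightOneSpectrum (𝓞 K) in cofinite, r.IsUnramifiedAt v ∧ A.IsUnramifiedAt v ∧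
      ∀ 𝔓 ∈ v.primesAbove, ∀ σ : Field.absoluteGaloisGroup K, IsArithFrobAt (𝓞 K) σ 𝔓 →
        A.charpoly σ ∣ r.charpoly σ :=
    hrunr.mono fun v hv => ⟨hv, (hur v hv).1, fun 𝔓 _ σ _ => ⟨D.charpoly σ, hcp σ⟩⟩
  have hdivD : ∀ᶠ v : HeightOneSpectrum (𝓞 K) in cofinite, r.IsUnramifiedAt v ∧ D.IsUnramifiedAt v ∧
      ∀ 𝔓 ∈ v.primesAbove, ∀ σ : Field.absoluteGaloisGroup K, IsArithFrobAt (𝓞 K) σ 𝔓 →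
        D.charpoly σ ∣ r.charpoly σ :=
    hrunr.mono fun v hv => ⟨hv, (hur v hv).2, fun 𝔓 _ σ _ => ⟨A.charpoly σ, by rw [hcp σ, mul_comm]⟩⟩
  -- Böckle–Hui Thm 1.1 in GL(1) form: both characters are attached to cuspidal GL(1) data
  obtain ⟨χA, -, hχA⟩ := hWA K h1 ℓ 2 E ((ι.symm : ℂ ≃+* PadicAlgCl ℓ).toRingHom.comp E.subtype)
    r hss hrat A hdivA ι
  obtain ⟨χD, -, hχD⟩ := hWA K h1 ℓ 2 E ((ι.symm : ℂ ≃+* PadicAlgCl ℓ).toRingHom.comp E.subtype)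
    r hss hrat D hdivD ι
  -- isobaric rigidity for `GL₂` versus `GL₁ ⊞ GL₁`
  refine (isobaricRigidity_of_JS h22 h23 K 2 hcpt two_pos π 2 (fun _ => 1) (fun _ => h1)
    (fun i => ![χA, χD] i) le_rfl (fun _ => one_pos) ?_).elim
  filter_upwards [hr, hχA, hχD] with v hv hvA hvD
  intro α hα
  obtain ⟨α₀, hα₀, -, hcpv⟩ := hv
  obtain rfl : α = α₀ := AutomorphicRepData.hasSatakeParamAt_unique_holds π.1 hα hα₀
  obtain ⟨c, hc, -, hcpA⟩ := hvA
  obtain ⟨d, hd, -, hcpD⟩ := hvD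
  refine ⟨![{c}, {d}], Fin.forall_fin_two.2 ⟨hc, hd⟩, ?_⟩
  -- the Frobenius polynomial of `r` is the product of those of `A` and `D`
  have hprod : r.HasFrobCharpolyAt v
      (arithFrobPolyOfSatake ι v.residueCard 1 {c} * arithFrobPolyOfSatake ι v.residueCard 1 {d}) := by
    intro 𝔓 h𝔓 τ hτ
    rw [hcp τ, hcpA 𝔓 h𝔓 τ hτ, hcpD 𝔓 h𝔓 τ hτ]
  rw [← arithFrobPolyOfSatake_add] at hprod
  have heq : arithFrobPolyOfSatake ι v.residueCard 1 α =
      arithFrobPolyOfSatake ι v.residueCard 1 ({c} + {d}) :=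
    GaloisRep.HasFrobCharpolyAt.unique_holds
      ((FramedGaloisRep.hasFrobCharpolyAt_toGaloisRep_iff v _ r).mpr hcpv)
      ((FramedGaloisRep.hasFrobCharpolyAt_toGaloisRep_iff v _ r).mpr hprod)
  rw [arithFrobPolyOfSatake_one_injective ι _ heq, Fin.sum_univ_two]
  rfl

end Summit.Langlands.Langlands.Theorems.IrreducibleOffSector

end
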